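import Literature.Barriers.CriticalPhenomena.PlaquetteWalkHoleRootStructuralKill
import HarnessLib

/-!
# Barrier catalogue (SAWScalingLimit): the QUADRANT PARITY form of the structural honeycomb kills at the far cell of a
hole root — no hypothesis on the western pocket

Sequel to `PlaquetteWalkHoleRootStructuralKill` (§§0–11: the structural `w₂`/`w₁`-kills of the far-cell defect of a
hole root in the `W`-normalisation, from the tree's winding parity law at the root; there the cells west of the POCKET
CELL `(w.1 − 3, w.2 − 1)` were analysed door by door: §2 «no western door», §9 «a dead-end column»). Here the pocket
analysis is replaced by ONE parity count, which needs no hypothesis on the western cells at all.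

Let `Q` be the south-western QUADRANT of cells `(x, y)` with `x ≤ w.1 − 3`, `y ≤ w.2 − 1` (west of the far cell's column,
below the far cell's row; `InQuadSW`). Its boundary in the lattice consists of its TOP edges (`IsTopEdgeSW`) — exactly the
edges `m ≥ 2` of the half-line running west from the root along the bottom line of the root row — and its EAST edges
(`IsEastEdgeSW`), the `W` sides of the cells `(w.1 − 2, y)`, `y ≤ w.2 − 1`, of the far cell's column. The excursion of a
class-`B2a` walk at the far cell starts and ends next to the far cell, outside `Q`, so it crosses the boundary of `Q` an
EVEN number of times (`even_card_changes_iff`: a Boolean sequence with equal end values changes value an even number of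
times; `quadrant_change_iff`: consecutive arcs lie on different sides of `Q` iff the edge between them is a top or an east
edge); by the parity law (`ExcursionJordan.AJ_root_ne_zero_iff_odd_rayCountAt`, presentation `(w, W)` of the root edge)
it crosses the top edges an ODD number of times (the edges `m = 0, 1` — the hole's and the far cell's bottom sides — are
never crossed by the excursion of an under-walk); hence it crosses the east edges an odd number of times — at least once
(★★ `ΩG.exists_nth_isEastEdgeSW_of_AJ_ne_zero`). With the kill cell `K_S2 = (w.1 − 3, w.2 − 2)` absent and the column
pair `(w.1 − 3, y)`, `(w.1 − 2, y)` not both present OR `(w.1 − 3, y)` a dead end (its `W`, `S`, `N` neighbours absent —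
`ΩG.fc_ne_of_deadEnd`) for `y ≤ w.2 − 3` (no USABLE western door of the far cell's column below the kill row — vacuous in
a box whose hole sits two rows above the bottom, and met by the corner cell `(0,0)` when the hole sits three rows up and
`K_S2 = (0,1)`), the only usable east door is the `W` side of the cell below the far cell: the excursion has an arc there through `W` (★★ `ΩG.exists_excursion_arc_farSW_W_of_AJ_ne_zero_quadrant`)
and the parent file's §4 finishes: ★★★ `ΩG.kindsIn_farSW_eq_of_wound_under_quadrant` — every wound class-`B2a` under-walk
at the far cell has `kindsIn (farSW w) = [coCorner, coCorner]`; `ΩG.under_killed_of_killSW_quadrant` (the companion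
`PlaquetteWalkHoleRootKillForcedZeros`' hypothesis `hS₂`). The row-mirror twin by the parent file's transport
`ΩG.mirrorFar`: ★★★ `ΩG.kindsIn_farNW_eq_of_wound_over_quadrant` / `ΩG.over_killed_of_killNW_quadrant` (`K_N1 =
(w.1 − 3, w.2 + 2)`, no western door above the kill row; `ΩG.kindsIn_eq_corner_of_mirrorFar_coCorner`). §2:
★★★★ `vertexFunctional_printed_farCellW_exists_eq_zero_Ioo_of_kills_quadrant` — hole, the two corner cells, the two
column conditions, ONE `w₂`-free wound over-walk and ONE `w₁`-free wound under-walk ⇒ an exact zero of the Yang–Baxter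
vertex functional of the hole root in `(π/3, 2π/3)`; the two sign theorems at `π/3` / `2π/3`.

§3 (edition 2): the KILL-ROW variant — `ΩG.odd_card_eastEdgeSW_of_AJ_ne_zero` (the counting form of the parity
lemma), ★★ `ΩG.exists_excursion_arc_farSW_W_of_AJ_ne_zero_killRow` (a second parity count on the sub-quadrant below the
kill row, whose top edges are not doors when the kill row's bottom line is uncrossable west of the kill cell: its east
crossings are even, so the crossing at the `W` side of the cell below the far cell is odd), ★★★
`ΩG.kindsIn_farSW_eq_of_wound_under_killRow` / `under_killed_of_killSW_killRow` and the mirror twins `…over_killRow` —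
hypotheses hole + `K_S2` + «`(x, w.2 − 2)` or `(x, w.2 − 3)` absent for `x ≤ w.1 − 4`», i.e. EVERY kill cell on the WEST WALL
of a box at ANY height (vacuous row condition), with nothing assumed below the kill row;
★★★★ `vertexFunctional_printed_farCellW_exists_eq_zero_Ioo_of_kills_killRow`.

Scope (venture lane «pcv-sawmu», HOME `FINDING-YB-KILL-FORCED-ZEROS.md` §12, seat b-step0 gen 24): this form subsumes
§§2, 5, 6, 8, 9 of the parent file and covers EVERY `K_S2` / `K_N1` row of the lane's corner-kill table (LAW L), in every
frame — including the hole-in-column-4 boxes `7×5 ∖ (4,2)`, `8×5 ∖ (4,2)` with two live columns west of the pocket —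
whatever the cells west of the far cell's western neighbour look like. Axioms `propext`, `Classical.choice`, `Quot.sound`.
Not in print; elementary given the parent files.

References: A. Glazman, I. Manolescu, arXiv:1708.00395v3, §1 (Fig. 1, Fig. 2) and Lemma 2.1 [GlazmanManolescu2019];
A. Glazman, Electron. Commun. Probab. 20 (2015) no. 86, Lemma 3.1, proof pp. 6–7 [Glazman2015WeightedSAW]; R. Courant,
H. Robbins, *What is Mathematics?* (1941/1958), Ch. V Appendix §2 (the even–odd rule for polygons) [CourantRobbins1958];
H. Duminil-Copin, S. Smirnov, Ann. of Math. 175 (2012), Lemma 1 [DuminilCopinSmirnov2012].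
-/

noncomputable section

/-! ## §1 The quadrant, its boundary edges, and the parity of boundary crossings

The pocket lemmas of §2 and §9 analysed the cells west of the pocket one by one. They are all instances of a single
parity count. Let `Q` be the south-western QUADRANT of cells `(x, y)` with `x ≤ w.1 − 3`, `y ≤ w.2 − 1` (west of the far
cell's column, below the far cell's row). Its boundary in the lattice consists of its TOP edges — exactly the edges
`m ≥ 2` of the half-line running west from the root along the bottom line of the root row — and its EAST edges, the `W`
sides of the cells `(w.1 − 2, y)`, `y ≤ w.2 − 1`, of the far cell's column. The excursion of a class-`B2a` walk at the far
cell starts and ends next to the far cell, outside `Q`, so it crosses the boundary of `Q` an EVEN number of times; by the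
parity law it crosses the top edges an ODD number of times (§1: the edges `m = 0, 1` are never crossed); hence it crosses
the east edges an odd number of times — at least once. With the kill cell `K_S2 = (w.1 − 3, w.2 − 2)` absent and the
column pair `(w.1 − 3, y)`, `(w.1 − 2, y)` not both present for `y ≤ w.2 − 3`, the only east door is the `W` side of the
cell below the far cell: the excursion has an arc there through `W`, and §4 finishes. NOTHING is assumed about the cells
west of the pocket (any shape, any number of live columns): this covers every `K_S2` / `K_N1` row of the lane's corner-kill
table, including the hole-in-column-4 frames `7×5 ∖ (4,2)`, `8×5 ∖ (4,2)`. -/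

namespace Literature.Probability.RandomPlanarGeometry.SAW.YangBaxter

open Real
open Literature.Barriers.CriticalPhenomena.PlaquetteWalk (mirrorRow mirrorRowFace mirrorSide mirrorKind mirrorArc
  mirrorRow_side arcsOf_map_mirrorRow arcKind_mirrorSide mirrorRowFace_mirrorRowFace mirrorSide_mirrorSide
  mirrorKind_mirrorKind)

open private fc_fh fc_ne from Literature.Probability.RandomPlanarGeometry.YangBaxterSAWGeneralDomain

section QuadrantCells

variable (w : Face)

/-- The south-western quadrant of the far cell: the cells west of its column and below its row.
[cite: CourantRobbins1958, Ch. V Appendix §2 (The Jordan Curve Theorem for Polygons: the even–odd rule)] -/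
def InQuadSW (c : Face) : Prop := c.1 ≤ w.1 - 3 ∧ c.2 ≤ w.2 - 1

/-- The top edges of the quadrant: the bottom line of the root row west of the far cell.
[cite: CourantRobbins1958, Ch. V Appendix §2 (the even–odd rule)] -/
def IsTopEdgeSW : MidEdge → Prop
  | .slant x y => x ≤ w.1 - 3 ∧ y = w.2
  | .vert _ _ => False

/-- The east edges of the quadrant: the west sides of the far cell's column below the far cell.
[cite: CourantRobbins1958, Ch. V Appendix §2 (the even–odd rule)] -/
def IsEastEdgeSW : MidEdge → Prop
  | .vert x y => x = w.1 - 2 ∧ y ≤ w.2 - 1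
  | .slant _ _ => False

/-- **Crossing the boundary of the quadrant**: two distinct faces sharing the mid-edge `e` lie on different sides of the
quadrant iff `e` is a top edge or an east edge. [cite: CourantRobbins1958, Ch. V Appendix §2 (the even–odd rule)] -/
theorem quadrant_change_iff {e : MidEdge} {F₁ F₂ : Face} (h₁ : ∃ s, F₁.side s = e) (h₂ : ∃ s, F₂.side s = e)
    (hne : F₁ ≠ F₂) : ¬(InQuadSW w F₁ ↔ InQuadSW w F₂) ↔ (IsTopEdgeSW w e ∨ IsEastEdgeSW w e) := by
  rcases (Face.exists_side_eq_iff F₁ e).1 h₁ with e₁ | e₁ <;> rcases (Face.exists_side_eq_iff F₂ e).1 h₂ with e₂ | e₂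
  · exact absurd (e₁.trans e₂.symm) hne
  · subst e₁; subst e₂
    cases e <;> simp only [MidEdge.faces, InQuadSW, IsTopEdgeSW, IsEastEdgeSW, or_false, false_or] <;> omega
  · subst e₁; subst e₂
    cases e <;> simp only [MidEdge.faces, InQuadSW, IsTopEdgeSW, IsEastEdgeSW, or_false, false_or] <;> omega
  · exact absurd (e₁.trans e₂.symm) hne

/-- A top edge is not an east edge. [cite: CourantRobbins1958, Ch. V Appendix §2 (the even–odd rule)] -/
theorem not_isTopEdgeSW_and_isEastEdgeSW (e : MidEdge) : ¬(IsTopEdgeSW w e ∧ IsEastEdgeSW w e) := by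
  cases e <;> simp [IsTopEdgeSW, IsEastEdgeSW]

/-- The ray edges `m ≥ 2` are top edges, and conversely. [cite: CourantRobbins1958, Ch. V Appendix §2 (the even–odd rule)] -/
theorem isTopEdgeSW_iff (e : MidEdge) : IsTopEdgeSW w e ↔ ∃ m : ℕ, 2 ≤ m ∧ e = rayMid w .W m := by
  constructor
  · intro h
    cases e with
    | vert x y => exact absurd h (by simp [IsTopEdgeSW])
    | slant x y =>
      simp only [IsTopEdgeSW] at h
      refine ⟨(w.1 - 1 - x).toNat, by omega, ?_⟩
      rw [rayMid_W_eq]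
      congr 1 <;> omega
  · rintro ⟨m, hm, rfl⟩
    rw [rayMid_W_eq]
    simp only [IsTopEdgeSW, and_true]
    omega

/-- A face next to the far cell (sharing a side with it, other than the far cell itself) is outside the quadrant.
[cite: GlazmanManolescu2019, §1 (the lattice of rhombi and its mid-edges)] -/
theorem not_inQuadSW_of_side_farW {F : Face} {s t : Side} (h : F.side s = (farW w).side t) (hne : F ≠ farW w) :
    ¬InQuadSW w F := by
  rcases (Face.exists_side_eq_iff F ((farW w).side t)).1 ⟨s, h⟩ with e | e <;>
    obtain ⟨k, j⟩ := w <;> cases t <;>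
      simp only [farW, Face.side, MidEdge.faces, InQuadSW] at e hne ⊢ <;>
      (subst e; first | (exact absurd rfl hne) | (simp only [not_and, not_le]; omega))

/-- The sides of the far cell are neither top nor east edges. [cite: GlazmanManolescu2019, §1 (the lattice of rhombi and its mid-edges)] -/
theorem farW_side_not_top_not_east (t : Side) : ¬IsTopEdgeSW w ((farW w).side t) ∧ ¬IsEastEdgeSW w ((farW w).side t) := by
  obtain ⟨k, j⟩ := w
  cases t <;> simp only [farW, Face.side, IsTopEdgeSW, IsEastEdgeSW, not_false_eq_true, and_true, true_and, not_and]
    <;> omega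

/-- **Parity of boundary crossings**: the number of indices in `(a, c]` at which a Boolean sequence changes value is even
iff the sequence has the same value at `a` and at `c` (the counting step of the even–odd rule).
[cite: CourantRobbins1958, Ch. V Appendix §2 (The Jordan Curve Theorem for Polygons: the even–odd rule)] -/
theorem even_card_changes_iff (b : ℕ → Bool) (a : ℕ) :
    ∀ c, a ≤ c → (Even (((Finset.Ioc a c).filter fun k => b (k - 1) ≠ b k).card) ↔ b a = b c) := by
  intro c hac
  induction c, hac using Nat.le_induction with
  | base => simp
  | succ c hac ih =>
    have hsplit : Finset.Ioc a (c + 1) = insert (c + 1) (Finset.Ioc a c) := by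
      ext k; simp [Finset.mem_Ioc, Finset.mem_insert]; omega
    have hnot : c + 1 ∉ Finset.Ioc a c := by simp
    rw [hsplit, Finset.filter_insert]
    by_cases hch : b (c + 1 - 1) ≠ b (c + 1)
    · rw [if_pos hch, Finset.card_insert_of_notMem (fun hm => hnot (Finset.mem_filter.1 hm).1), Nat.even_add_one, ih]
      rw [show c + 1 - 1 = c by omega] at hch
      constructor
      · intro h1
        cases hb : b a <;> cases hc : b c <;> cases hc1 : b (c + 1) <;> simp_all
      · intro h1
        cases hb : b a <;> cases hc : b c <;> cases hc1 : b (c + 1) <;> simp_all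
    · rw [if_neg hch, ih]
      rw [show c + 1 - 1 = c by omega] at hch
      push Not at hch
      rw [hch]

end QuadrantCells

namespace ΩG

variable {D : Set Face} {w : Face}

/-- ★★ **THE QUADRANT PARITY LEMMA.** For a class-`B2a` walk at the far cell with first side `S` whose excursion polygon
winds around the root (hole absent): the excursion crosses the EAST side of the south-western quadrant — the `W` side of
some cell `(w.1 − 2, y)`, `y ≤ w.2 − 1`, of the far cell's column — at some interior index. (Boundary crossings of the
quadrant are even; top crossings are the ray count, odd.) [cite: CourantRobbins1958, Ch. V Appendix §2 (The Jordan Curve Theorem for Polygons: the even–odd rule)]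
[cite: Glazman2015WeightedSAW, Lemma 3.1 (proof, pp. 6–7: the classes of walks through a rhombus)] -/
theorem exists_nth_isEastEdgeSW_of_AJ_ne_zero (hh : holeFaceW w ∉ D)
    (ω : ΩG D (w.side .W) (farW w)) (hr : RootedFace D (w.side .W) (farW w)) (h : ω.IsB2a)
    (hS : ω.2.firstSideG = .S) (hA : ω.AJ hr h (toC (midPt (w.side .W))) ≠ 0) :
    ∃ k, ω.2.firstHitG + 2 ≤ k ∧ k + 1 ≤ ω.2.arcs.length - 1 + 1 ∧ k ≤ ω.2.arcs.length - 1 ∧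
      IsEastEdgeSW w (ω.2.nth k) := by
  classical
  have hodd := (ω.AJ_root_ne_zero_iff_odd_rayCountAt (hr := hr) h (b := w) (τ := .W) rfl).1 hA
  have hF := ω.fh_lt h
  have hB2 : ω.2.firstHitG + 1 < ω.2.arcs.length := h.1
  have hfcF : ω.2.fc ω.2.firstHitG = farW w := (fc_fh ω hr h).1
  set F := ω.2.firstHitG with hFdef
  set n := ω.2.arcs.length with hndef
  -- the membership sequence and the index range `(F+1, n-1]`
  let b : ℕ → Bool := fun k => decide (InQuadSW w (ω.2.fc k))
  -- endpoints: the first and the last excursion arcs lie next to the far cell, outside the quadrant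
  have hbF : b (F + 1) = false := by
    have hin := (ω.2.side_sIn_nth (i := F + 1) hB2).1
    rw [(ω.2.exitSide_specG hr hF).1] at hin
    have hne : ω.2.fc (F + 1) ≠ farW w := fc_ne ω hr h (by omega) hB2
    simp only [b, decide_eq_false_iff_not]
    exact not_inQuadSW_of_side_farW w hin hne
  have hbL : b (n - 1) = false := by
    have hout := (ω.2.side_sIn_nth (i := n - 1) (by omega)).2.1
    rw [show n - 1 + 1 = n by omega, ω.2.nth_length] at hout
    have hne : ω.2.fc (n - 1) ≠ farW w := fc_ne ω hr h (by omega) (by omega)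
    simp only [b, decide_eq_false_iff_not]
    exact not_inQuadSW_of_side_farW w hout hne
  -- the change set is even
  have heven := (even_card_changes_iff b (F + 1) (n - 1) (by omega)).2 (hbF.trans hbL.symm)
  -- a change at `k` is a top or east crossing at `nth k`
  have hchg : ∀ k ∈ Finset.Ioc (F + 1) (n - 1),
      (b (k - 1) ≠ b k ↔ IsTopEdgeSW w (ω.2.nth k) ∨ IsEastEdgeSW w (ω.2.nth k)) := by
    intro k hk
    rw [Finset.mem_Ioc] at hk
    have hout := (ω.2.side_sIn_nth (i := k - 1) (by omega)).2.1
    have hin := (ω.2.side_sIn_nth (i := k) (by omega)).1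
    rw [show k - 1 + 1 = k by omega] at hout
    have hne : ω.2.fc (k - 1) ≠ ω.2.fc (k - 1 + 1) := YBWalk.fc_succ_ne (by omega)
    rw [show k - 1 + 1 = k by omega] at hne
    have key := quadrant_change_iff w ⟨_, hout⟩ ⟨_, hin⟩ hne
    simp only [b, ne_eq, decide_eq_decide]
    exact key
  -- split the change set into top and east crossings
  set K := Finset.Ioc (F + 1) (n - 1) with hKdef
  set T := K.filter fun k => IsTopEdgeSW w (ω.2.nth k) with hTdef
  set E := K.filter fun k => IsEastEdgeSW w (ω.2.nth k) with hEdef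
  have hsplit : (K.filter fun k => b (k - 1) ≠ b k) = T ∪ E := by
    ext k
    simp only [hTdef, hEdef, Finset.mem_union, Finset.mem_filter]
    constructor
    · rintro ⟨hk, hb⟩
      rcases (hchg k hk).1 hb with ht | he
      · exact Or.inl ⟨hk, ht⟩
      · exact Or.inr ⟨hk, he⟩
    · rintro (⟨hk, ht⟩ | ⟨hk, he⟩)
      · exact ⟨hk, (hchg k hk).2 (Or.inl ht)⟩
      · exact ⟨hk, (hchg k hk).2 (Or.inr he)⟩
  have hdisj : Disjoint T E := by
    rw [Finset.disjoint_filter]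
    intro k _ ht he
    exact not_isTopEdgeSW_and_isEastEdgeSW w _ ⟨ht, he⟩
  rw [hsplit, Finset.card_union_of_disjoint hdisj] at heven
  -- the top crossings are the ray count: odd
  have hT : T.card = ω.rayCountAt hr h w .W := by
    unfold ΩG.rayCountAt
    have hexit : ∀ j < ω.Mv, (ω.jFace h j).side (ω.jOut hr h j) = ω.2.nth (F + j + 1) := by
      intro j hj
      have hjn : F + j < n := by unfold ΩG.Mv at hj; omega
      by_cases hj0 : j = 0
      · subst hj0
        simp only [ΩG.jFace, ΩG.jOut, Nat.add_zero]
        exact (ω.2.exitSide_specG hr hF).1.symm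
      · simp only [ΩG.jFace, ΩG.jOut, if_neg hj0]
        exact (ω.2.side_sIn_nth hjn).2.1
    have hFM : F + ω.Mv = n := by unfold ΩG.Mv; omega
    symm
    refine Finset.card_bij' (fun j _ => F + j + 1) (fun k _ => k - F - 1) ?_ ?_ ?_ ?_
    · intro j hj
      rw [Finset.mem_filter, Finset.mem_range] at hj
      obtain ⟨hjM, m, hm⟩ := hj
      rw [hexit j hjM] at hm
      -- `m ≥ 2`: the hole's bottom side is no door, the far cell's bottom side is the first side
      have hlt : F + j + 1 ≤ n - 1 ∧ F + 2 ≤ F + j + 1 := by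
        have h1 : F + j + 1 ≠ n := by
          intro e
          rw [e, ω.2.nth_length, rayMid_W_eq] at hm
          exact (ω.firstSide_exit_return_distinct hr h).2.1 (hS.trans (farW_side_eq_slant_row w hm).1.symm)
        have h2 : j ≠ 0 := by
          rintro rfl
          rw [Nat.add_zero, (ω.2.exitSide_specG hr hF).1, rayMid_W_eq] at hm
          exact (ω.2.exitSide_specG hr hF).2 ((farW_side_eq_slant_row w hm).1.trans hS.symm)
        omega
      have hm2 : 2 ≤ m := by
        by_contra hlt2
        have hdoor := ω.2.door_nth (j := F + j + 1) (by omega) (by omega)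
        rw [hm, rayMid_W_eq] at hdoor
        simp only [MidEdge.faces] at hdoor
        obtain rfl | rfl : m = 0 ∨ m = 1 := by omega
        · refine hh ?_
          have e : holeFaceW w = (w.1 - 1 - ((0 : ℕ) : ℤ), w.2) := by simp [holeFaceW]
          rw [e]; exact hdoor.2
        · have e1 : (w.1 - 1 - ((1 : ℕ) : ℤ)) = w.1 - 2 := by push_cast; ring
          have e : ω.2.nth (F + j + 1) = ω.2.nth F := by
            rw [hm, rayMid_W_eq, e1, ω.2.nth_firstHitG, hS]; rfl
          have := ω.2.nth_inj (by omega) hF.le e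
          omega
      rw [hTdef, Finset.mem_filter, hKdef, Finset.mem_Ioc]
      exact ⟨⟨by omega, hlt.1⟩, (isTopEdgeSW_iff w _).2 ⟨m, hm2, hm⟩⟩
    · intro k hk
      rw [hTdef, Finset.mem_filter, hKdef, Finset.mem_Ioc] at hk
      obtain ⟨⟨hk1, hk2⟩, ht⟩ := hk
      obtain ⟨m, -, hm⟩ := (isTopEdgeSW_iff w _).1 ht
      rw [Finset.mem_filter, Finset.mem_range]
      refine ⟨by omega, m, ?_⟩
      rw [hexit _ (by omega), show F + (k - F - 1) + 1 = k by omega]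
      exact hm
    · intro j hj; omega
    · intro k hk
      rw [hTdef, Finset.mem_filter, hKdef, Finset.mem_Ioc] at hk
      omega
  rw [hT] at heven
  -- so the east crossings are odd, in particular non-empty
  have hEodd : Odd E.card := by
    rcases Nat.even_or_odd E.card with he | he
    · exact absurd heven (Nat.not_even_iff_odd.2 (hodd.add_even he))
    · exact he
  obtain ⟨k, hk⟩ := Finset.card_pos.1 hEodd.pos
  rw [hEdef, Finset.mem_filter, hKdef, Finset.mem_Ioc] at hk
  exact ⟨k, by omega, by omega, hk.1.2, hk.2⟩

/-- The faces of the four sides of a cell, generically. [cite: GlazmanManolescu2019, §1 (the lattice of rhombi and its mid-edges)] -/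
theorem faces_side_cellQ (c : Face) :
    (c.side .W).faces = ((c.1 - 1, c.2), c) ∧ (c.side .E).faces = (c, (c.1 + 1, c.2)) ∧
      (c.side .S).faces = ((c.1, c.2 - 1), c) ∧ (c.side .N).faces = (c, (c.1, c.2 + 1)) := by
  obtain ⟨a, b⟩ := c; simp [Face.side, MidEdge.faces]

/-- **A dead end carries no interior arc**: a cell whose western, southern and northern neighbours are absent holds no
arc of the walk at an index with a predecessor and a successor (both of its edges would have to be its eastern door).
[cite: Glazman2015WeightedSAW, Lemma 3.1 (proof, pp. 6–7: the classes of walks through a rhombus)] -/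
theorem fc_ne_of_deadEnd (c : Face) (hW : ((c.1 - 1, c.2) : Face) ∉ D) (hSo : ((c.1, c.2 - 1) : Face) ∉ D)
    (hNo : ((c.1, c.2 + 1) : Face) ∉ D) (ω : ΩG D (w.side .W) (farW w)) {i : ℕ} (hi0 : 0 < i)
    (hi : i + 1 < ω.2.arcs.length) : ω.2.fc i ≠ c := by
  intro e
  obtain ⟨hin, hout, hne⟩ := ω.2.side_sIn_nth (i := i) (by omega)
  rw [e] at hin hout
  have hdin := ω.2.door_nth (j := i) hi0 (by omega)
  have hdout := ω.2.door_nth (j := i + 1) (by omega) hi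
  rw [← hin] at hdin
  rw [← hout] at hdout
  obtain ⟨fW, fE, fS, fN⟩ := faces_side_cellQ c
  have key : ∀ s : Side, ((c.side s).faces.1 ∈ D ∧ (c.side s).faces.2 ∈ D) → s = .E := by
    intro s hs
    cases s
    · rw [fW] at hs; exact absurd hs.1 hW
    · rfl
    · rw [fS] at hs; exact absurd hs.1 hSo
    · rw [fN] at hs; exact absurd hs.2 hNo
  exact hne ((key _ hdin).trans (key _ hdout).symm)

/-- ★★ **THE POCKET LEMMA, QUADRANT FORM.** Hole and kill cell `K_S2 = (w.1 − 3, w.2 − 2)` absent, and for every row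
`y ≤ w.2 − 3` the western door of the far cell's column at that row is UNUSABLE — one of `(w.1 − 3, y)`, `(w.1 − 2, y)`
absent, or `(w.1 − 3, y)` a dead end (its `W`, `S`, `N` neighbours absent; e.g. the corner cell `(0, 0)` of a box once
`K_S2 = (0, 1)` is gone) —: the excursion of such a walk has an arc in the cell below the far cell through its `W` side —
WHATEVER the cells west of the pocket look like. [cite: CourantRobbins1958, Ch. V Appendix §2 (the even–odd rule)]
[cite: Glazman2015WeightedSAW, Lemma 3.1 (proof, pp. 6–7: the classes of walks through a rhombus)] -/
theorem exists_excursion_arc_farSW_W_of_AJ_ne_zero_quadrant (hh : holeFaceW w ∉ D) (hK : killSW w ∉ D)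
    (hcol : ∀ y : ℤ, y ≤ w.2 - 3 → (w.1 - 3, y) ∉ D ∨ (w.1 - 2, y) ∉ D ∨
      (((w.1 - 4, y) : Face) ∉ D ∧ ((w.1 - 3, y - 1) : Face) ∉ D ∧ ((w.1 - 3, y + 1) : Face) ∉ D))
    (ω : ΩG D (w.side .W) (farW w)) (hr : RootedFace D (w.side .W) (farW w)) (h : ω.IsB2a)
    (hS : ω.2.firstSideG = .S) (hA : ω.AJ hr h (toC (midPt (w.side .W))) ≠ 0) :
    ∃ k, ω.2.firstHitG < k ∧ k < ω.2.arcs.length ∧ ω.2.fc k = farSW w ∧ (ω.2.sIn k = .W ∨ ω.2.sOut k = .W) := by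
  obtain ⟨k, hk1, -, hk2, he⟩ := ω.exists_nth_isEastEdgeSW_of_AJ_ne_zero hh hr h hS hA
  have hF := ω.fh_lt h
  set F := ω.2.firstHitG with hFdef
  set n := ω.2.arcs.length with hndef
  -- the east edge `nth k = vert (w.1 - 2) y`
  cases hnth : ω.2.nth k with
  | slant x y => rw [hnth] at he; exact absurd he (by simp [IsEastEdgeSW])
  | vert x y =>
    rw [hnth] at he
    simp only [IsEastEdgeSW] at he
    obtain ⟨hx, hy⟩ := he
    -- it is a door: both faces `(w.1 - 3, y)`, `(w.1 - 2, y)` lie in `D` ⇒ `y = w.2 - 1`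
    have hdoor := ω.2.door_nth (j := k) (by omega) (by omega)
    rw [hnth] at hdoor
    simp only [MidEdge.faces] at hdoor
    have hy1 : y = w.2 - 1 := by
      rcases lt_or_eq_of_le hy with hlt | heq
      · exfalso
        rcases lt_or_eq_of_le (show y ≤ w.2 - 2 by omega) with hlt2 | heq2
        · rw [hx] at hdoor
          have e3 : ((w.1 - 3, y) : Face) = (w.1 - 2 - 1, y) := Prod.ext (by show w.1 - 3 = w.1 - 2 - 1; ring) rfl
          rcases hcol y (by omega) with hc | hc | ⟨hcW, hcS, hcN⟩
          · exact hc (by rw [e3]; exact hdoor.1)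
          · exact hc hdoor.2
          · -- the western cell `c = (w.1 - 3, y)` is a dead end: no arc of the walk lies in it, yet one of the arcs
            -- `k - 1`, `k` does (they are the two faces of the crossed edge)
            set c : Face := (w.1 - 3, y) with hcdef
            have hcw : ((c.1 - 1, c.2) : Face) ∉ D := by
              have e : ((c.1 - 1, c.2) : Face) = (w.1 - 4, y) := Prod.ext (by show w.1 - 3 - 1 = w.1 - 4; ring) rfl
              rw [e]; exact hcW
            have hcs : ((c.1, c.2 - 1) : Face) ∉ D := hcS
            have hcn : ((c.1, c.2 + 1) : Face) ∉ D := hcN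
            have hout := (ω.2.side_sIn_nth (i := k - 1) (by omega)).2.1
            have hin := (ω.2.side_sIn_nth (i := k) (by omega)).1
            rw [show k - 1 + 1 = k by omega, hnth] at hout
            rw [hnth] at hin
            have hf1 := (Face.exists_side_eq_iff _ _).1 ⟨_, hout⟩
            have hf2 := (Face.exists_side_eq_iff _ _).1 ⟨_, hin⟩
            simp only [MidEdge.faces] at hf1 hf2
            rw [hx, ← e3] at hf1 hf2
            have hne : ω.2.fc (k - 1) ≠ ω.2.fc (k - 1 + 1) := YBWalk.fc_succ_ne (by omega)
            rw [show k - 1 + 1 = k by omega] at hne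
            rcases hf1 with e1 | e1
            · exact ω.fc_ne_of_deadEnd c hcw hcs hcn (i := k - 1) (by omega) (by omega) e1
            · rcases hf2 with e2 | e2
              · -- arc `k` lies in `c`: it is not the last arc (the last arc leaves through a side of the far cell)
                have hkn : k + 1 < n := by
                  rcases Nat.lt_or_ge (k + 1) n with hl | hl
                  · exact hl
                  · exfalso
                    have hlast := (ω.2.side_sIn_nth (i := k) (by omega)).2.1
                    rw [show k + 1 = n by omega, ω.2.nth_length, e2] at hlast
                    have hq := not_inQuadSW_of_side_farW w hlast (fun e => by
                      have := congrArg Prod.fst e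
                      simp only [hcdef, farW] at this
                      omega)
                    exact hq ⟨by simp [hcdef], by show y ≤ w.2 - 1; omega⟩
                exact ω.fc_ne_of_deadEnd c hcw hcs hcn (i := k) (by omega) hkn e2
              · exact hne (e1.trans e2.symm)
        · apply hK
          have e : killSW w = (x - 1, y) := by rw [hx, heq2]; simp [killSW]; ring
          rw [e]; exact hdoor.1
      · exact heq
    -- so `nth k` is the `W` side of the cell below the far cell; arcs `k - 1` and `k` lie in the pocket and in that cell
    have hgW : ω.2.nth k = (farSW w).side .W := by
      rw [hnth, hx, hy1]; obtain ⟨a, c⟩ := w; simp [farSW, Face.side]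
    have hout := (ω.2.side_sIn_nth (i := k - 1) (by omega)).2.1
    have hin := (ω.2.side_sIn_nth (i := k) (by omega)).1
    rw [show k - 1 + 1 = k by omega, hgW] at hout
    rw [hgW] at hin
    have hf1 := (Face.exists_side_eq_iff _ _).1 ⟨_, hout⟩
    have hf2 := (Face.exists_side_eq_iff _ _).1 ⟨_, hin⟩
    rw [← pocketSW_side_E, pocketSW_side_E_faces] at hf1 hf2
    simp only at hf1 hf2
    have hne : ω.2.fc (k - 1) ≠ ω.2.fc (k - 1 + 1) := YBWalk.fc_succ_ne (by omega)
    rw [show k - 1 + 1 = k by omega] at hne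
    rcases hf2 with e2 | e2
    · -- arc `k` lies in the pocket, so arc `k - 1` lies in `farSW w` and exits `W`
      have e1 : ω.2.fc (k - 1) = farSW w := by
        rcases hf1 with e | e
        · exact absurd (e.trans e2.symm) hne
        · exact e
      exact ⟨k - 1, by omega, by omega, e1, Or.inr (Face.side_injective (farSW w) (by rw [e1] at hout; exact hout))⟩
    · exact ⟨k, by omega, by omega, e2, Or.inl (Face.side_injective (farSW w) (by rw [e2] at hin; exact hin))⟩

/-- ★★★ **THE STRUCTURAL UNDER-ROUTE `w₂`-KILL, QUADRANT FORM** — the weakest hypotheses of this file: hole, kill cell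
`K_S2 = (w.1 − 3, w.2 − 2)`, and no western door of the far cell's column below the kill row. Every wound class-`B2a`
under-walk at the far cell carries `kindsIn (farSW w) = [coCorner, coCorner]`.
[cite: GlazmanManolescu2019, §1, Fig. 1 and the paragraph of Fig. 2 («if θ = π/3, then w₂ = 0»)]
[cite: Glazman2015WeightedSAW, Lemma 3.1 (proof, pp. 6–7)] [cite: CourantRobbins1958, Ch. V Appendix §2 (the even–odd rule)] -/
theorem kindsIn_farSW_eq_of_wound_under_quadrant (hh : holeFaceW w ∉ D) (hK : killSW w ∉ D)
    (hcol : ∀ y : ℤ, y ≤ w.2 - 3 → (w.1 - 3, y) ∉ D ∨ (w.1 - 2, y) ∉ D ∨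
      (((w.1 - 4, y) : Face) ∉ D ∧ ((w.1 - 3, y - 1) : Face) ∉ D ∧ ((w.1 - 3, y + 1) : Face) ∉ D))
    (ω : ΩG D (w.side .W) (farW w)) (hr : RootedFace D (w.side .W) (farW w)) (h : ω.IsB2a)
    (hS : ω.2.firstSideG = .S) {θ : ℝ}
    (hW : ω.WE (fun _ => θ) ≠ excursionWinding θ ω.2.firstSideG (ω.z1 hr h) ω.1) :
    ω.2.kindsIn (farSW w) = [.coCorner, .coCorner] := by
  rcases ω.AJ_ne_zero_or_rev_of_wound hr h θ hW with hA | hA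
  · obtain ⟨k, hFk, hkn, hfck, hkW⟩ := ω.exists_excursion_arc_farSW_W_of_AJ_ne_zero_quadrant hh hK hcol hr h hS hA
    exact ω.kindsIn_farSW_eq_of_excursion_arc_W h hS hFk hkn hfck hkW
  · have h' := ω.rev_isB2a hr h
    have hS' : (ω.rev hr).2.firstSideG = .S := (ω.rev_firstSide hr h).trans hS
    obtain ⟨k, hFk, hkn, hfck, hkW⟩ :=
      (ω.rev hr).exists_excursion_arc_farSW_W_of_AJ_ne_zero_quadrant hh hK hcol hr h' hS' hA
    have hk := (ω.rev hr).kindsIn_farSW_eq_of_excursion_arc_W h' hS' hFk hkn hfck hkW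
    have hperm := ω.kindsIn_rev_perm hr h (farSW_ne_farW w)
    rw [hk] at hperm
    have hp : (ω.2.kindsIn (farSW w)).Perm (List.replicate 2 .coCorner) := hperm.symm
    exact List.perm_replicate.1 hp

/-- ★★★ The companion file's hypothesis `hS₂`, discharged under the quadrant hypotheses.
[cite: GlazmanManolescu2019, §1 (the paragraph of Fig. 2)] [cite: CourantRobbins1958, Ch. V Appendix §2 (the even–odd rule)] -/
theorem under_killed_of_killSW_quadrant (hh : holeFaceW w ∉ D) (hK : killSW w ∉ D)
    (hcol : ∀ y : ℤ, y ≤ w.2 - 3 → (w.1 - 3, y) ∉ D ∨ (w.1 - 2, y) ∉ D ∨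
      (((w.1 - 4, y) : Face) ∉ D ∧ ((w.1 - 3, y - 1) : Face) ∉ D ∧ ((w.1 - 3, y + 1) : Face) ∉ D))
    (hr : RootedFace D (w.side .W) (farW w)) (θ : ℝ) :
    ∀ (ω : ΩG D (w.side .W) (farW w)) (h : ω.IsB2a), ω.2.firstSideG = .S →
      ω.WE (fun _ => θ) ≠ excursionWinding θ ω.2.firstSideG (ω.z1 hr h) ω.1 → ¬ω.2.W2FreeOff (farW w) :=
  fun ω h hS hW => ω.not_W2FreeOff_farW_of_kindsIn_farSW
    (ω.kindsIn_farSW_eq_of_wound_under_quadrant hh hK hcol hr h hS hW)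

/-- **Generic mirror transfer of a doubled rhombus, dual direction**: two `(π − θ)`-corner arcs of the reflected walk
in `g` are two `θ`-corner arcs of the walk in the reflected rhombus. [cite: GlazmanManolescu2019, §1, Fig. 1 (θ ↔ π − θ exchanges the corner kinds)] -/
theorem kindsIn_eq_corner_of_mirrorFar_coCorner (ω : ΩG D (w.side .W) (farW w)) {g : Face}
    (hk : ω.mirrorFar.2.kindsIn g = [.coCorner, .coCorner]) :
    ω.2.kindsIn (mirrorRowFace w.2 g) = [.corner, .corner] := by
  obtain ⟨i, j, hij, hj, hfi, hfj⟩ := ω.mirrorFar.2.exists_two_arcs_of_two_le_length_kindsIn (f := g) (by rw [hk]; simp)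
  have hn := ω.mirrorFar_length
  have hi0 : i < ω.2.arcs.length := by omega
  have hj0 : j < ω.2.arcs.length := by omega
  have hface : ∀ {m : ℕ}, m < ω.2.arcs.length → ω.mirrorFar.2.fc m = g → ω.2.fc m = mirrorRowFace w.2 g := by
    intro m hm e
    have e1 := ω.mirrorFar_fc hm
    rw [e] at e1
    have e2 := congrArg (mirrorRowFace w.2) e1
    rw [mirrorRowFace_mirrorRowFace] at e2
    exact e2.symm
  have hkind : ∀ {m : ℕ}, m < ω.2.arcs.length → ω.mirrorFar.2.fc m = g → arcKind (ω.2.sIn m) (ω.2.sOut m) = .corner := by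
    intro m hm e
    have hmem := ω.mirrorFar.2.arcKind_mem_kindsIn (i := m) (by omega)
    obtain ⟨e1, e2⟩ := ω.mirrorFar_sIn_sOut hm
    rw [e, hk, e1, e2, arcKind_mirrorSide] at hmem
    have e3 : mirrorKind (arcKind (ω.2.sIn m) (ω.2.sOut m)) = .coCorner := by simpa using hmem
    have e4 := congrArg mirrorKind e3
    rw [mirrorKind_mirrorKind] at e4
    exact e4
  have hfci := hface hi0 hfi
  have hfcj := hface hj0 hfj
  rw [← hfci]
  exact ω.2.kindsIn_eq_corner_corner hi0 hj0 hij (hfcj.trans hfci.symm) (hkind hi0 hfi) (hkind hj0 hfj)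

/-- ★★★ **THE STRUCTURAL OVER-ROUTE `w₁`-KILL, QUADRANT FORM** (row-mirror twin): hole, `K_N1 = (w.1 − 3, w.2 + 2)`
absent, no western door of the far cell's column above the kill row ⇒ every wound over-walk has
`kindsIn (farNW w) = [corner, corner]`. [cite: GlazmanManolescu2019, §1, Fig. 1 and the remark after eq. (1)]
[cite: Glazman2015WeightedSAW, Lemma 3.1 (proof, pp. 6–7)] [cite: CourantRobbins1958, Ch. V Appendix §2 (the even–odd rule)] -/
theorem kindsIn_farNW_eq_of_wound_over_quadrant (hh : holeFaceW w ∉ D) (hK : killNW w ∉ D)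
    (hcol : ∀ y : ℤ, w.2 + 3 ≤ y → (w.1 - 3, y) ∉ D ∨ (w.1 - 2, y) ∉ D ∨
      (((w.1 - 4, y) : Face) ∉ D ∧ ((w.1 - 3, y + 1) : Face) ∉ D ∧ ((w.1 - 3, y - 1) : Face) ∉ D))
    (ω : ΩG D (w.side .W) (farW w)) (hr : RootedFace D (w.side .W) (farW w)) (h : ω.IsB2a)
    (hN : ω.2.firstSideG = .N) {θ : ℝ}
    (hW : ω.WE (fun _ => θ) ≠ excursionWinding θ ω.2.firstSideG (ω.z1 hr h) ω.1) :
    ω.2.kindsIn (farNW w) = [.corner, .corner] := by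
  have hr' := rootedFace_rowMirrorDom w hr
  have h' := ω.mirrorFar_isB2a hr h
  have hh' : holeFaceW w ∉ rowMirrorDom w D := by rwa [mem_rowMirrorDom, mirrorRowFace_holeFaceW]
  have hK' : killSW w ∉ rowMirrorDom w D := by rwa [mem_rowMirrorDom, mirrorRowFace_killSW]
  have hcol' : ∀ y : ℤ, y ≤ w.2 - 3 → (w.1 - 3, y) ∉ rowMirrorDom w D ∨ (w.1 - 2, y) ∉ rowMirrorDom w D ∨
      (((w.1 - 4, y) : Face) ∉ rowMirrorDom w D ∧ ((w.1 - 3, y - 1) : Face) ∉ rowMirrorDom w D ∧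
        ((w.1 - 3, y + 1) : Face) ∉ rowMirrorDom w D) := by
    intro y hy
    simp only [mem_rowMirrorDom, mirrorRowFace]
    have e1 : 2 * w.2 - (y - 1) = 2 * w.2 - y + 1 := by ring
    have e2 : 2 * w.2 - (y + 1) = 2 * w.2 - y - 1 := by ring
    rw [e1, e2]
    exact hcol (2 * w.2 - y) (by omega)
  have hS' : ω.mirrorFar.2.firstSideG = .S := by rw [mirrorFar_firstSideG, hN]; rfl
  have hk := ω.mirrorFar.kindsIn_farSW_eq_of_wound_under_quadrant hh' hK' hcol' hr' h' hS' (ω.mirrorFar_wound hr h hW)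
  have hk2 := ω.kindsIn_eq_corner_of_mirrorFar_coCorner hk
  rwa [mirrorRowFace_farSW] at hk2

/-- ★★★ The companion file's hypothesis `hN₁`, discharged under the quadrant hypotheses.
[cite: GlazmanManolescu2019, §1, remark after eq. (1)] [cite: CourantRobbins1958, Ch. V Appendix §2 (the even–odd rule)] -/
theorem over_killed_of_killNW_quadrant (hh : holeFaceW w ∉ D) (hK : killNW w ∉ D)
    (hcol : ∀ y : ℤ, w.2 + 3 ≤ y → (w.1 - 3, y) ∉ D ∨ (w.1 - 2, y) ∉ D ∨
      (((w.1 - 4, y) : Face) ∉ D ∧ ((w.1 - 3, y + 1) : Face) ∉ D ∧ ((w.1 - 3, y - 1) : Face) ∉ D))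
    (hr : RootedFace D (w.side .W) (farW w)) (θ : ℝ) :
    ∀ (ω : ΩG D (w.side .W) (farW w)) (h : ω.IsB2a), ω.2.firstSideG = .N →
      ω.WE (fun _ => θ) ≠ excursionWinding θ ω.2.firstSideG (ω.z1 hr h) ω.1 → ¬ω.2.W1FreeOff (farW w) := by
  intro ω h hN hW hfree
  have hk := ω.kindsIn_farNW_eq_of_wound_over_quadrant hh hK hcol hr h hN hW
  have hmem : farNW w ∈ ω.2.facesVisited := by
    by_contra hn
    rw [YBWalk.kindsIn_eq_nil hn] at hk
    exact List.cons_ne_nil _ _ hk.symm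
  exact hfree _ hmem (farNW_ne_farW w) hk

end ΩG

end Literature.Probability.RandomPlanarGeometry.SAW.YangBaxter

/-! ## §2 The far-cell defect under the quadrant hypotheses -/

namespace Literature.Barriers.CriticalPhenomena.PlaquetteWalk

open Literature.Probability.RandomPlanarGeometry.SAW.YangBaxter
open Real Complex

/-- ★★★★ **THE KILL-FORCED ZERO, QUADRANT FORM** — the weakest hypotheses of this file for the far-cell west pair: hole,
the two corner cells `K_S2 = (w.1 − 3, w.2 − 2)` and `K_N1 = (w.1 − 3, w.2 + 2)` absent, and the far cell's column
without a western door beyond the two kill rows (`(w.1 − 3, y)`, `(w.1 − 2, y)` not both present for `y ≤ w.2 − 3` and for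
`y ≥ w.2 + 3` — vacuous in every box of the lane whose hole sits two rows from top and bottom); ONE `w₂`-free wound
over-walk and ONE `w₁`-free wound under-walk ⇒ an exact zero of the Yang–Baxter vertex functional of the hole root in
`(π/3, 2π/3)`. Nothing is assumed about the cells west of the far cell's western neighbour.
[cite: GlazmanManolescu2019, Lemma 2.1 (statement, "in the form given in [Gl]")]
[cite: GlazmanManolescu2019, §1 (the paragraph of Fig. 2 and the remark after eq. (1))]
[cite: Glazman2015WeightedSAW, Lemma 3.1 (proof, pp. 6–7)] [cite: DuminilCopinSmirnov2012, proof of Lemma 1]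
[cite: CourantRobbins1958, Ch. V Appendix §2 (The Jordan Curve Theorem for Polygons: the even–odd rule)] -/
theorem vertexFunctional_printed_farCellW_exists_eq_zero_Ioo_of_kills_quadrant (Dl : List Face) (w : Face)
    (hf : farW w ∈ Dl) (hh : holeFaceW w ∉ dom Dl) (hr : RootedFace (dom Dl) (w.side .W) (farW w))
    (hKS : killSW w ∉ dom Dl) (hKN : killNW w ∉ dom Dl)
    (hcolS : ∀ y : ℤ, y ≤ w.2 - 3 → (w.1 - 3, y) ∉ dom Dl ∨ (w.1 - 2, y) ∉ dom Dl ∨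
      (((w.1 - 4, y) : Face) ∉ dom Dl ∧ ((w.1 - 3, y - 1) : Face) ∉ dom Dl ∧ ((w.1 - 3, y + 1) : Face) ∉ dom Dl))
    (hcolN : ∀ y : ℤ, w.2 + 3 ≤ y → (w.1 - 3, y) ∉ dom Dl ∨ (w.1 - 2, y) ∉ dom Dl ∨
      (((w.1 - 4, y) : Face) ∉ dom Dl ∧ ((w.1 - 3, y + 1) : Face) ∉ dom Dl ∧ ((w.1 - 3, y - 1) : Face) ∉ dom Dl))
    (hN₂ : ∃ (ω : ΩG (dom Dl) (w.side .W) (farW w)) (h : ω.IsB2a), ω.2.firstSideG = .N ∧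
      ω.WE (fun _ => π / 3) ≠ excursionWinding (π / 3) ω.2.firstSideG (ω.z1 hr h) ω.1 ∧ ω.2.W2FreeOff (farW w))
    (hS₁ : ∃ (ω : ΩG (dom Dl) (w.side .W) (farW w)) (h : ω.IsB2a), ω.2.firstSideG = .S ∧
      ω.WE (fun _ => 2 * π / 3) ≠ excursionWinding (2 * π / 3) ω.2.firstSideG (ω.z1 hr h) ω.1 ∧
        ω.2.W1FreeOff (farW w)) :
    ∃ θ ∈ Set.Ioo (π / 3) (2 * π / 3),
      vertexFunctional (printedWeights θ) tFiveEighths (ybCoeff θ) Dl (w.side .W) (farW w) = 0 :=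
  vertexFunctional_printed_farCellW_exists_eq_zero_Ioo_of_opposite_kills Dl w hf hh hr
    (ΩG.under_killed_of_killSW_quadrant hh hKS hcolS hr (π / 3)) hN₂
    (ΩG.over_killed_of_killNW_quadrant hh hKN hcolN hr (2 * π / 3)) hS₁

/-- ★★★ The structural honeycomb sign, quadrant form: `Im VF(π/3) > 0` from the hole, `K_S2`, the column condition and
ONE `w₂`-free wound over-walk. [cite: GlazmanManolescu2019, Lemma 2.1 (statement, "in the form given in [Gl]")]
[cite: GlazmanManolescu2019, §1 (the paragraph of Fig. 2: «if θ = π/3, then w₂ = 0»)] -/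
theorem im_vertexFunctional_printed_farCellW_pi_div_three_pos_of_killSW_quadrant (Dl : List Face) (w : Face)
    (hf : farW w ∈ Dl) (hh : holeFaceW w ∉ dom Dl) (hr : RootedFace (dom Dl) (w.side .W) (farW w))
    (hK : killSW w ∉ dom Dl) (hcol : ∀ y : ℤ, y ≤ w.2 - 3 → (w.1 - 3, y) ∉ dom Dl ∨ (w.1 - 2, y) ∉ dom Dl ∨
      (((w.1 - 4, y) : Face) ∉ dom Dl ∧ ((w.1 - 3, y - 1) : Face) ∉ dom Dl ∧ ((w.1 - 3, y + 1) : Face) ∉ dom Dl))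
    (hN : ∃ (ω : ΩG (dom Dl) (w.side .W) (farW w)) (h : ω.IsB2a), ω.2.firstSideG = .N ∧
      ω.WE (fun _ => π / 3) ≠ excursionWinding (π / 3) ω.2.firstSideG (ω.z1 hr h) ω.1 ∧ ω.2.W2FreeOff (farW w)) :
    0 < (vertexFunctional (printedWeights (π / 3)) tFiveEighths (ybCoeff (π / 3)) Dl (w.side .W) (farW w)).im :=
  im_vertexFunctional_printed_farCellW_pi_div_three_pos_of_under_killed Dl w hf hh hr
    (ΩG.under_killed_of_killSW_quadrant hh hK hcol hr (π / 3)) hN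

/-- ★★★ The structural dual sign, quadrant form: `Im VF(2π/3) < 0` from the hole, `K_N1`, the column condition and ONE
`w₁`-free wound under-walk. [cite: GlazmanManolescu2019, Lemma 2.1 (statement, "in the form given in [Gl]")]
[cite: GlazmanManolescu2019, §1, remark after eq. (1)] -/
theorem im_vertexFunctional_printed_farCellW_two_pi_div_three_neg_of_killNW_quadrant (Dl : List Face) (w : Face)
    (hf : farW w ∈ Dl) (hh : holeFaceW w ∉ dom Dl) (hr : RootedFace (dom Dl) (w.side .W) (farW w))
    (hK : killNW w ∉ dom Dl) (hcol : ∀ y : ℤ, w.2 + 3 ≤ y → (w.1 - 3, y) ∉ dom Dl ∨ (w.1 - 2, y) ∉ dom Dl ∨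
      (((w.1 - 4, y) : Face) ∉ dom Dl ∧ ((w.1 - 3, y + 1) : Face) ∉ dom Dl ∧ ((w.1 - 3, y - 1) : Face) ∉ dom Dl))
    (hS : ∃ (ω : ΩG (dom Dl) (w.side .W) (farW w)) (h : ω.IsB2a), ω.2.firstSideG = .S ∧
      ω.WE (fun _ => 2 * π / 3) ≠ excursionWinding (2 * π / 3) ω.2.firstSideG (ω.z1 hr h) ω.1 ∧
        ω.2.W1FreeOff (farW w)) :
    (vertexFunctional (printedWeights (2 * π / 3)) tFiveEighths (ybCoeff (2 * π / 3)) Dl (w.side .W)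
      (farW w)).im < 0 :=
  im_vertexFunctional_printed_farCellW_two_pi_div_three_neg_of_over_killed Dl w hf hh hr
    (ΩG.over_killed_of_killNW_quadrant hh hK hcol hr (2 * π / 3)) hS

end Literature.Barriers.CriticalPhenomena.PlaquetteWalk

namespace Literature.Probability.RandomPlanarGeometry.SAW.YangBaxter

open Real
open Literature.Barriers.CriticalPhenomena.PlaquetteWalk (mirrorRow mirrorRowFace mirrorSide mirrorKind mirrorArc
  mirrorRow_side arcsOf_map_mirrorRow arcKind_mirrorSide mirrorRowFace_mirrorRowFace mirrorSide_mirrorSide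
  mirrorKind_mirrorKind)

open private fc_fh fc_ne from Literature.Probability.RandomPlanarGeometry.YangBaxterSAWGeneralDomain

namespace ΩG

/-! ## §3 (edition 2) The KILL-ROW variant: west-wall kill cells at any height

The column condition of §1 («no usable western door of the far cell's column below the kill row») holds in a box only
when the kill cell lies on the bottom wall (or one row above it, through the dead-end clause). When the kill cell lies
on the WEST wall at any height — `K_S2 = (0, w.2 − 2)`, `w.1 = 3` — the rows below it carry live western doors of the far
cell's column, but they all lead into the column-`0` POCKET below the kill cell, which has no other exit: a second parity
count, on the SUB-QUADRANT `{x ≤ w.1 − 3, y ≤ w.2 − 3}` (= `InQuadSW (w.1, w.2 − 2)`), whose top edges run along the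
bottom line of the KILL ROW west of the far cell's column and are assumed uncrossable (`∀ x ≤ w.1 − 4`, `(x, w.2 − 2)` or
`(x, w.2 − 3)` absent — the kill cell itself is the case `x = w.1 − 3`), shows that the east crossings at rows `≤ w.2 − 3`
are EVEN; the crossing at row `w.2 − 2` is impossible (kill cell); so the crossings at row `w.2 − 1` — the `W` side of
the cell below the far cell — are ODD. -/

section KillRow

variable {D : Set Face} {w : Face}

open scoped Classical in
/-- ★★ **THE QUADRANT PARITY LEMMA, counting form** (edition 2): the number of interior indices at which the excursion
crosses an EAST edge of the south-western quadrant is ODD. [cite: CourantRobbins1958, Ch. V Appendix §2 (The Jordan Curve Theorem for Polygons: the even–odd rule)]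
[cite: Glazman2015WeightedSAW, Lemma 3.1 (proof, pp. 6–7: the classes of walks through a rhombus)] -/
theorem odd_card_eastEdgeSW_of_AJ_ne_zero (hh : holeFaceW w ∉ D)
    (ω : ΩG D (w.side .W) (farW w)) (hr : RootedFace D (w.side .W) (farW w)) (h : ω.IsB2a)
    (hS : ω.2.firstSideG = .S) (hA : ω.AJ hr h (toC (midPt (w.side .W))) ≠ 0) :
    Odd (((Finset.Ioc (ω.2.firstHitG + 1) (ω.2.arcs.length - 1)).filter
      fun k => IsEastEdgeSW w (ω.2.nth k)).card) := by
  classical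
  have hodd := (ω.AJ_root_ne_zero_iff_odd_rayCountAt (hr := hr) h (b := w) (τ := .W) rfl).1 hA
  have hF := ω.fh_lt h
  have hB2 : ω.2.firstHitG + 1 < ω.2.arcs.length := h.1
  have hfcF : ω.2.fc ω.2.firstHitG = farW w := (fc_fh ω hr h).1
  set F := ω.2.firstHitG with hFdef
  set n := ω.2.arcs.length with hndef
  -- the membership sequence and the index range `(F+1, n-1]`
  let b : ℕ → Bool := fun k => decide (InQuadSW w (ω.2.fc k))
  -- endpoints: the first and the last excursion arcs lie next to the far cell, outside the quadrant
  have hbF : b (F + 1) = false := by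
    have hin := (ω.2.side_sIn_nth (i := F + 1) hB2).1
    rw [(ω.2.exitSide_specG hr hF).1] at hin
    have hne : ω.2.fc (F + 1) ≠ farW w := fc_ne ω hr h (by omega) hB2
    simp only [b, decide_eq_false_iff_not]
    exact not_inQuadSW_of_side_farW w hin hne
  have hbL : b (n - 1) = false := by
    have hout := (ω.2.side_sIn_nth (i := n - 1) (by omega)).2.1
    rw [show n - 1 + 1 = n by omega, ω.2.nth_length] at hout
    have hne : ω.2.fc (n - 1) ≠ farW w := fc_ne ω hr h (by omega) (by omega)
    simp only [b, decide_eq_false_iff_not]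
    exact not_inQuadSW_of_side_farW w hout hne
  -- the change set is even
  have heven := (even_card_changes_iff b (F + 1) (n - 1) (by omega)).2 (hbF.trans hbL.symm)
  -- a change at `k` is a top or east crossing at `nth k`
  have hchg : ∀ k ∈ Finset.Ioc (F + 1) (n - 1),
      (b (k - 1) ≠ b k ↔ IsTopEdgeSW w (ω.2.nth k) ∨ IsEastEdgeSW w (ω.2.nth k)) := by
    intro k hk
    rw [Finset.mem_Ioc] at hk
    have hout := (ω.2.side_sIn_nth (i := k - 1) (by omega)).2.1
    have hin := (ω.2.side_sIn_nth (i := k) (by omega)).1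
    rw [show k - 1 + 1 = k by omega] at hout
    have hne : ω.2.fc (k - 1) ≠ ω.2.fc (k - 1 + 1) := YBWalk.fc_succ_ne (by omega)
    rw [show k - 1 + 1 = k by omega] at hne
    have key := quadrant_change_iff w ⟨_, hout⟩ ⟨_, hin⟩ hne
    simp only [b, ne_eq, decide_eq_decide]
    exact key
  -- split the change set into top and east crossings
  set K := Finset.Ioc (F + 1) (n - 1) with hKdef
  set T := K.filter fun k => IsTopEdgeSW w (ω.2.nth k) with hTdef
  set E := K.filter fun k => IsEastEdgeSW w (ω.2.nth k) with hEdef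
  have hsplit : (K.filter fun k => b (k - 1) ≠ b k) = T ∪ E := by
    ext k
    simp only [hTdef, hEdef, Finset.mem_union, Finset.mem_filter]
    constructor
    · rintro ⟨hk, hb⟩
      rcases (hchg k hk).1 hb with ht | he
      · exact Or.inl ⟨hk, ht⟩
      · exact Or.inr ⟨hk, he⟩
    · rintro (⟨hk, ht⟩ | ⟨hk, he⟩)
      · exact ⟨hk, (hchg k hk).2 (Or.inl ht)⟩
      · exact ⟨hk, (hchg k hk).2 (Or.inr he)⟩
  have hdisj : Disjoint T E := by
    rw [Finset.disjoint_filter]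
    intro k _ ht he
    exact not_isTopEdgeSW_and_isEastEdgeSW w _ ⟨ht, he⟩
  rw [hsplit, Finset.card_union_of_disjoint hdisj] at heven
  -- the top crossings are the ray count: odd
  have hT : T.card = ω.rayCountAt hr h w .W := by
    unfold ΩG.rayCountAt
    have hexit : ∀ j < ω.Mv, (ω.jFace h j).side (ω.jOut hr h j) = ω.2.nth (F + j + 1) := by
      intro j hj
      have hjn : F + j < n := by unfold ΩG.Mv at hj; omega
      by_cases hj0 : j = 0
      · subst hj0
        simp only [ΩG.jFace, ΩG.jOut, Nat.add_zero]
        exact (ω.2.exitSide_specG hr hF).1.symm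
      · simp only [ΩG.jFace, ΩG.jOut, if_neg hj0]
        exact (ω.2.side_sIn_nth hjn).2.1
    have hFM : F + ω.Mv = n := by unfold ΩG.Mv; omega
    symm
    refine Finset.card_bij' (fun j _ => F + j + 1) (fun k _ => k - F - 1) ?_ ?_ ?_ ?_
    · intro j hj
      rw [Finset.mem_filter, Finset.mem_range] at hj
      obtain ⟨hjM, m, hm⟩ := hj
      rw [hexit j hjM] at hm
      -- `m ≥ 2`: the hole's bottom side is no door, the far cell's bottom side is the first side
      have hlt : F + j + 1 ≤ n - 1 ∧ F + 2 ≤ F + j + 1 := by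
        have h1 : F + j + 1 ≠ n := by
          intro e
          rw [e, ω.2.nth_length, rayMid_W_eq] at hm
          exact (ω.firstSide_exit_return_distinct hr h).2.1 (hS.trans (farW_side_eq_slant_row w hm).1.symm)
        have h2 : j ≠ 0 := by
          rintro rfl
          rw [Nat.add_zero, (ω.2.exitSide_specG hr hF).1, rayMid_W_eq] at hm
          exact (ω.2.exitSide_specG hr hF).2 ((farW_side_eq_slant_row w hm).1.trans hS.symm)
        omega
      have hm2 : 2 ≤ m := by
        by_contra hlt2
        have hdoor := ω.2.door_nth (j := F + j + 1) (by omega) (by omega)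
        rw [hm, rayMid_W_eq] at hdoor
        simp only [MidEdge.faces] at hdoor
        obtain rfl | rfl : m = 0 ∨ m = 1 := by omega
        · refine hh ?_
          have e : holeFaceW w = (w.1 - 1 - ((0 : ℕ) : ℤ), w.2) := by simp [holeFaceW]
          rw [e]; exact hdoor.2
        · have e1 : (w.1 - 1 - ((1 : ℕ) : ℤ)) = w.1 - 2 := by push_cast; ring
          have e : ω.2.nth (F + j + 1) = ω.2.nth F := by
            rw [hm, rayMid_W_eq, e1, ω.2.nth_firstHitG, hS]; rfl
          have := ω.2.nth_inj (by omega) hF.le e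
          omega
      rw [hTdef, Finset.mem_filter, hKdef, Finset.mem_Ioc]
      exact ⟨⟨by omega, hlt.1⟩, (isTopEdgeSW_iff w _).2 ⟨m, hm2, hm⟩⟩
    · intro k hk
      rw [hTdef, Finset.mem_filter, hKdef, Finset.mem_Ioc] at hk
      obtain ⟨⟨hk1, hk2⟩, ht⟩ := hk
      obtain ⟨m, -, hm⟩ := (isTopEdgeSW_iff w _).1 ht
      rw [Finset.mem_filter, Finset.mem_range]
      refine ⟨by omega, m, ?_⟩
      rw [hexit _ (by omega), show F + (k - F - 1) + 1 = k by omega]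
      exact hm
    · intro j hj; omega
    · intro k hk
      rw [hTdef, Finset.mem_filter, hKdef, Finset.mem_Ioc] at hk
      omega
  rw [hT] at heven
  -- so the east crossings are odd, in particular non-empty
  have hEodd : Odd E.card := by
    rcases Nat.even_or_odd E.card with he | he
    · exact absurd heven (Nat.not_even_iff_odd.2 (hodd.add_even he))
    · exact he
  rw [hEdef, hKdef] at hEodd
  exact hEodd


/-- ★★ **THE POCKET LEMMA, KILL-ROW FORM.** Hole and kill cell `K_S2 = (w.1 − 3, w.2 − 2)` absent and the bottom line of
the kill row uncrossable west of the kill cell (`∀ x ≤ w.1 − 4`, `(x, w.2 − 2) ∉ D ∨ (x, w.2 − 3) ∉ D`; NOTHING about the far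
cell's column below the kill row, nothing about the pocket): the excursion of such a walk has an arc in the cell below the
far cell through its `W` side. [cite: CourantRobbins1958, Ch. V Appendix §2 (the even–odd rule)]
[cite: Glazman2015WeightedSAW, Lemma 3.1 (proof, pp. 6–7: the classes of walks through a rhombus)] -/
theorem exists_excursion_arc_farSW_W_of_AJ_ne_zero_killRow (hh : holeFaceW w ∉ D) (hK : killSW w ∉ D)
    (hkrow : ∀ x : ℤ, x ≤ w.1 - 4 → (x, w.2 - 2) ∉ D ∨ (x, w.2 - 3) ∉ D)
    (ω : ΩG D (w.side .W) (farW w)) (hr : RootedFace D (w.side .W) (farW w)) (h : ω.IsB2a)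
    (hS : ω.2.firstSideG = .S) (hA : ω.AJ hr h (toC (midPt (w.side .W))) ≠ 0) :
    ∃ k, ω.2.firstHitG < k ∧ k < ω.2.arcs.length ∧ ω.2.fc k = farSW w ∧ (ω.2.sIn k = .W ∨ ω.2.sOut k = .W) := by
  classical
  have hodd := ω.odd_card_eastEdgeSW_of_AJ_ne_zero hh hr h hS hA
  have hF := ω.fh_lt h
  have hB2 : ω.2.firstHitG + 1 < ω.2.arcs.length := h.1
  set F := ω.2.firstHitG with hFdef
  set n := ω.2.arcs.length with hndef
  set K := Finset.Ioc (F + 1) (n - 1) with hKdef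
  -- the sub-quadrant below the kill row: `InQuadSW w'` with `w' = (w.1, w.2 - 2)`
  set w' : Face := (w.1, w.2 - 2) with hw'
  let b : ℕ → Bool := fun k => decide (InQuadSW w' (ω.2.fc k))
  have hsub : ∀ c : Face, InQuadSW w' c → InQuadSW w c := by
    intro c hc; simp only [InQuadSW, hw'] at hc ⊢; omega
  have hbF : b (F + 1) = false := by
    have hin := (ω.2.side_sIn_nth (i := F + 1) hB2).1
    rw [(ω.2.exitSide_specG hr hF).1] at hin
    have hne : ω.2.fc (F + 1) ≠ farW w := fc_ne ω hr h (by omega) hB2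
    simp only [b, decide_eq_false_iff_not]
    exact fun hq => not_inQuadSW_of_side_farW w hin hne (hsub _ hq)
  have hbL : b (n - 1) = false := by
    have hout := (ω.2.side_sIn_nth (i := n - 1) (by omega)).2.1
    rw [show n - 1 + 1 = n by omega, ω.2.nth_length] at hout
    have hne : ω.2.fc (n - 1) ≠ farW w := fc_ne ω hr h (by omega) (by omega)
    simp only [b, decide_eq_false_iff_not]
    exact fun hq => not_inQuadSW_of_side_farW w hout hne (hsub _ hq)
  have heven := (even_card_changes_iff b (F + 1) (n - 1) (by omega)).2 (hbF.trans hbL.symm)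
  -- a change at `k` is an east crossing of the sub-quadrant (its top edges are not doors)
  have hchg : ∀ k ∈ K, (b (k - 1) ≠ b k ↔ IsEastEdgeSW w' (ω.2.nth k)) := by
    intro k hk
    rw [hKdef, Finset.mem_Ioc] at hk
    have hout := (ω.2.side_sIn_nth (i := k - 1) (by omega)).2.1
    have hin := (ω.2.side_sIn_nth (i := k) (by omega)).1
    rw [show k - 1 + 1 = k by omega] at hout
    have hne : ω.2.fc (k - 1) ≠ ω.2.fc (k - 1 + 1) := YBWalk.fc_succ_ne (by omega)
    rw [show k - 1 + 1 = k by omega] at hne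
    have key := quadrant_change_iff w' ⟨_, hout⟩ ⟨_, hin⟩ hne
    simp only [b, ne_eq, decide_eq_decide]
    rw [key]
    constructor
    · rintro (ht | he)
      · -- a top edge of the sub-quadrant would be a door on the kill row west of the far cell's column
        exfalso
        have hdoor := ω.2.door_nth (j := k) (by omega) (by omega)
        revert ht hdoor
        cases ω.2.nth k with
        | vert x y => intro ht; exact absurd ht (by simp [IsTopEdgeSW])
        | slant x y =>
          intro ht hdoor
          simp only [IsTopEdgeSW, hw'] at ht
          simp only [MidEdge.faces] at hdoor
          obtain ⟨hx, hy⟩ := ht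
          rcases lt_or_eq_of_le hx with hlt | heq
          · rcases hkrow x (by omega) with hc | hc
            · exact hc (by rw [← hy]; exact hdoor.2)
            · exact hc (by rw [show w.2 - 3 = y - 1 by omega]; exact hdoor.1)
          · apply hK
            have e : killSW w = (x, y) := by rw [heq, hy]; simp [killSW]
            rw [e]; exact hdoor.2
      · exact he
    · exact fun he => Or.inr he
  -- hence the east crossings of the sub-quadrant are even
  have hsplit : (K.filter fun k => b (k - 1) ≠ b k) = K.filter fun k => IsEastEdgeSW w' (ω.2.nth k) :=
    Finset.filter_congr fun k hk => hchg k hk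
  rw [← hKdef, hsplit] at heven
  -- the east crossings of the quadrant split by row: `≤ w.2 - 3` (sub-quadrant), `= w.2 - 2` (none), `= w.2 - 1`
  set E := K.filter fun k => IsEastEdgeSW w (ω.2.nth k) with hEdef
  set Elow := K.filter fun k => IsEastEdgeSW w' (ω.2.nth k) with hElowdef
  set Etop := K.filter fun k => ω.2.nth k = (farSW w).side .W with hEtopdef
  have hgW : (farSW w).side .W = MidEdge.vert (w.1 - 2) (w.2 - 1) := by
    obtain ⟨a, c⟩ := w; simp [farSW, Face.side]
  have hEsplit : E = Elow ∪ Etop := by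
    ext k
    simp only [hEdef, hElowdef, hEtopdef, Finset.mem_union, Finset.mem_filter]
    constructor
    · rintro ⟨hk, he⟩
      rw [hKdef, Finset.mem_Ioc] at hk
      revert he
      cases hnth : ω.2.nth k with
      | slant x y => intro he; exact absurd he (by simp [IsEastEdgeSW])
      | vert x y =>
        intro he
        simp only [IsEastEdgeSW] at he
        obtain ⟨hx, hy⟩ := he
        rcases lt_or_eq_of_le hy with hlt | heq
        · rcases lt_or_eq_of_le (show y ≤ w.2 - 2 by omega) with hlt2 | heq2
          · left
            refine ⟨by rw [hKdef, Finset.mem_Ioc]; exact hk, ?_⟩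
            simp only [IsEastEdgeSW, hw']
            exact ⟨hx, by omega⟩
          · -- row `w.2 - 2`: the door would put the kill cell in `D`
            exfalso
            have hdoor := ω.2.door_nth (j := k) (by omega) (by omega)
            rw [hnth] at hdoor
            simp only [MidEdge.faces] at hdoor
            apply hK
            have e : killSW w = (x - 1, y) := by rw [hx, heq2]; simp [killSW]; ring
            rw [e]; exact hdoor.1
        · right
          refine ⟨by rw [hKdef, Finset.mem_Ioc]; exact hk, ?_⟩
          rw [hgW, hx, heq]
    · rintro (⟨hk, he⟩ | ⟨hk, he⟩)
      · refine ⟨hk, ?_⟩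
        revert he
        cases ω.2.nth k with
        | slant x y => intro he; exact absurd he (by simp [IsEastEdgeSW])
        | vert x y =>
          intro he
          simp only [IsEastEdgeSW, hw'] at he ⊢
          exact ⟨he.1, by omega⟩
      · refine ⟨hk, ?_⟩
        rw [he, hgW]
        simp only [IsEastEdgeSW, and_self, le_refl]
  have hdisj : Disjoint Elow Etop := by
    rw [hElowdef, hEtopdef, Finset.disjoint_filter]
    intro k _ he ht
    rw [ht, hgW] at he
    simp only [IsEastEdgeSW, hw'] at he
    omega
  rw [hEsplit, Finset.card_union_of_disjoint hdisj] at hodd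
  have hEtop : Odd Etop.card := by
    rcases Nat.even_or_odd Etop.card with he | he
    · exact absurd (heven.add he) (Nat.not_even_iff_odd.2 hodd)
    · exact he
  obtain ⟨k, hk⟩ := Finset.card_pos.1 hEtop.pos
  rw [hEtopdef, Finset.mem_filter, hKdef, Finset.mem_Ioc] at hk
  obtain ⟨⟨hk1, hk2⟩, hnth⟩ := hk
  -- arcs `k - 1` and `k` lie in the pocket and in the cell below the far cell
  have hout := (ω.2.side_sIn_nth (i := k - 1) (by omega)).2.1
  have hin := (ω.2.side_sIn_nth (i := k) (by omega)).1
  rw [show k - 1 + 1 = k by omega, hnth] at hout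
  rw [hnth] at hin
  have hf1 := (Face.exists_side_eq_iff _ _).1 ⟨_, hout⟩
  have hf2 := (Face.exists_side_eq_iff _ _).1 ⟨_, hin⟩
  rw [← pocketSW_side_E, pocketSW_side_E_faces] at hf1 hf2
  simp only at hf1 hf2
  have hne : ω.2.fc (k - 1) ≠ ω.2.fc (k - 1 + 1) := YBWalk.fc_succ_ne (by omega)
  rw [show k - 1 + 1 = k by omega] at hne
  rcases hf2 with e2 | e2
  · have e1 : ω.2.fc (k - 1) = farSW w := by
      rcases hf1 with e | e
      · exact absurd (e.trans e2.symm) hne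
      · exact e
    exact ⟨k - 1, by omega, by omega, e1, Or.inr (Face.side_injective (farSW w) (by rw [e1] at hout; exact hout))⟩
  · exact ⟨k, by omega, by omega, e2, Or.inl (Face.side_injective (farSW w) (by rw [e2] at hin; exact hin))⟩

/-- ★★★ **THE STRUCTURAL UNDER-ROUTE `w₂`-KILL, KILL-ROW FORM**: hole, `K_S2`, and the bottom line of the kill row
uncrossable west of the kill cell ⇒ every wound class-`B2a` under-walk at the far cell has
`kindsIn (farSW w) = [coCorner, coCorner]` — e.g. a kill cell on the WEST WALL of a box at any height (`w.1 = 3`: the row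
condition is vacuous). [cite: GlazmanManolescu2019, §1, Fig. 1 and the paragraph of Fig. 2 («if θ = π/3, then w₂ = 0»)]
[cite: Glazman2015WeightedSAW, Lemma 3.1 (proof, pp. 6–7)] [cite: CourantRobbins1958, Ch. V Appendix §2 (the even–odd rule)] -/
theorem kindsIn_farSW_eq_of_wound_under_killRow (hh : holeFaceW w ∉ D) (hK : killSW w ∉ D)
    (hkrow : ∀ x : ℤ, x ≤ w.1 - 4 → (x, w.2 - 2) ∉ D ∨ (x, w.2 - 3) ∉ D)
    (ω : ΩG D (w.side .W) (farW w)) (hr : RootedFace D (w.side .W) (farW w)) (h : ω.IsB2a)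
    (hS : ω.2.firstSideG = .S) {θ : ℝ}
    (hW : ω.WE (fun _ => θ) ≠ excursionWinding θ ω.2.firstSideG (ω.z1 hr h) ω.1) :
    ω.2.kindsIn (farSW w) = [.coCorner, .coCorner] := by
  rcases ω.AJ_ne_zero_or_rev_of_wound hr h θ hW with hA | hA
  · obtain ⟨k, hFk, hkn, hfck, hkW⟩ := ω.exists_excursion_arc_farSW_W_of_AJ_ne_zero_killRow hh hK hkrow hr h hS hA
    exact ω.kindsIn_farSW_eq_of_excursion_arc_W h hS hFk hkn hfck hkW
  · have h' := ω.rev_isB2a hr h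
    have hS' : (ω.rev hr).2.firstSideG = .S := (ω.rev_firstSide hr h).trans hS
    obtain ⟨k, hFk, hkn, hfck, hkW⟩ :=
      (ω.rev hr).exists_excursion_arc_farSW_W_of_AJ_ne_zero_killRow hh hK hkrow hr h' hS' hA
    have hk := (ω.rev hr).kindsIn_farSW_eq_of_excursion_arc_W h' hS' hFk hkn hfck hkW
    have hperm := ω.kindsIn_rev_perm hr h (farSW_ne_farW w)
    rw [hk] at hperm
    have hp : (ω.2.kindsIn (farSW w)).Perm (List.replicate 2 .coCorner) := hperm.symm
    exact List.perm_replicate.1 hp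

/-- ★★★ The companion file's hypothesis `hS₂` in the kill-row geometry. [cite: GlazmanManolescu2019, §1 (the paragraph of Fig. 2)]
[cite: CourantRobbins1958, Ch. V Appendix §2 (the even–odd rule)] -/
theorem under_killed_of_killSW_killRow (hh : holeFaceW w ∉ D) (hK : killSW w ∉ D)
    (hkrow : ∀ x : ℤ, x ≤ w.1 - 4 → (x, w.2 - 2) ∉ D ∨ (x, w.2 - 3) ∉ D)
    (hr : RootedFace D (w.side .W) (farW w)) (θ : ℝ) :
    ∀ (ω : ΩG D (w.side .W) (farW w)) (h : ω.IsB2a), ω.2.firstSideG = .S →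
      ω.WE (fun _ => θ) ≠ excursionWinding θ ω.2.firstSideG (ω.z1 hr h) ω.1 → ¬ω.2.W2FreeOff (farW w) :=
  fun ω h hS hW => ω.not_W2FreeOff_farW_of_kindsIn_farSW
    (ω.kindsIn_farSW_eq_of_wound_under_killRow hh hK hkrow hr h hS hW)

/-- ★★★ **THE STRUCTURAL OVER-ROUTE `w₁`-KILL, KILL-ROW FORM** (row-mirror twin): hole, `K_N1 = (w.1 − 3, w.2 + 2)`, the
top line of the northern kill row uncrossable west of the kill cell (`∀ x ≤ w.1 − 4`, `(x, w.2 + 2) ∉ D ∨ (x, w.2 + 3) ∉ D`)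
⇒ every wound over-walk has `kindsIn (farNW w) = [corner, corner]`.
[cite: GlazmanManolescu2019, §1, Fig. 1 and the remark after eq. (1)] [cite: Glazman2015WeightedSAW, Lemma 3.1 (proof, pp. 6–7)]
[cite: CourantRobbins1958, Ch. V Appendix §2 (the even–odd rule)] -/
theorem kindsIn_farNW_eq_of_wound_over_killRow (hh : holeFaceW w ∉ D) (hK : killNW w ∉ D)
    (hkrow : ∀ x : ℤ, x ≤ w.1 - 4 → (x, w.2 + 2) ∉ D ∨ (x, w.2 + 3) ∉ D)
    (ω : ΩG D (w.side .W) (farW w)) (hr : RootedFace D (w.side .W) (farW w)) (h : ω.IsB2a)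
    (hN : ω.2.firstSideG = .N) {θ : ℝ}
    (hW : ω.WE (fun _ => θ) ≠ excursionWinding θ ω.2.firstSideG (ω.z1 hr h) ω.1) :
    ω.2.kindsIn (farNW w) = [.corner, .corner] := by
  have hr' := rootedFace_rowMirrorDom w hr
  have h' := ω.mirrorFar_isB2a hr h
  have hh' : holeFaceW w ∉ rowMirrorDom w D := by rwa [mem_rowMirrorDom, mirrorRowFace_holeFaceW]
  have hK' : killSW w ∉ rowMirrorDom w D := by rwa [mem_rowMirrorDom, mirrorRowFace_killSW]
  have hkrow' : ∀ x : ℤ, x ≤ w.1 - 4 → (x, w.2 - 2) ∉ rowMirrorDom w D ∨ (x, w.2 - 3) ∉ rowMirrorDom w D := by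
    intro x hx
    simp only [mem_rowMirrorDom, mirrorRowFace]
    have e1 : 2 * w.2 - (w.2 - 2) = w.2 + 2 := by ring
    have e2 : 2 * w.2 - (w.2 - 3) = w.2 + 3 := by ring
    rw [e1, e2]
    exact hkrow x hx
  have hS' : ω.mirrorFar.2.firstSideG = .S := by rw [mirrorFar_firstSideG, hN]; rfl
  have hk := ω.mirrorFar.kindsIn_farSW_eq_of_wound_under_killRow hh' hK' hkrow' hr' h' hS' (ω.mirrorFar_wound hr h hW)
  have hk2 := ω.kindsIn_eq_corner_of_mirrorFar_coCorner hk
  rwa [mirrorRowFace_farSW] at hk2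

/-- ★★★ The companion file's hypothesis `hN₁` in the kill-row geometry. [cite: GlazmanManolescu2019, §1, remark after eq. (1)]
[cite: CourantRobbins1958, Ch. V Appendix §2 (the even–odd rule)] -/
theorem over_killed_of_killNW_killRow (hh : holeFaceW w ∉ D) (hK : killNW w ∉ D)
    (hkrow : ∀ x : ℤ, x ≤ w.1 - 4 → (x, w.2 + 2) ∉ D ∨ (x, w.2 + 3) ∉ D)
    (hr : RootedFace D (w.side .W) (farW w)) (θ : ℝ) :
    ∀ (ω : ΩG D (w.side .W) (farW w)) (h : ω.IsB2a), ω.2.firstSideG = .N →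
      ω.WE (fun _ => θ) ≠ excursionWinding θ ω.2.firstSideG (ω.z1 hr h) ω.1 → ¬ω.2.W1FreeOff (farW w) := by
  intro ω h hN hW hfree
  have hk := ω.kindsIn_farNW_eq_of_wound_over_killRow hh hK hkrow hr h hN hW
  have hmem : farNW w ∈ ω.2.facesVisited := by
    by_contra hn
    rw [YBWalk.kindsIn_eq_nil hn] at hk
    exact List.cons_ne_nil _ _ hk.symm
  exact hfree _ hmem (farNW_ne_farW w) hk

end KillRow

end ΩG

end Literature.Probability.RandomPlanarGeometry.SAW.YangBaxter

namespace Literature.Barriers.CriticalPhenomena.PlaquetteWalk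

open Literature.Probability.RandomPlanarGeometry.SAW.YangBaxter
open Real Complex

/-- ★★★★ **THE KILL-FORCED ZERO, KILL-ROW FORM** — the two corner cells `K_S2`, `K_N1` on the WEST WALL of the domain at
any height (more generally: the bottom line of the southern kill row and the top line of the northern kill row
uncrossable west of the kill cells), hole absent, ONE `w₂`-free wound over-walk and ONE `w₁`-free wound under-walk ⇒ an
exact zero of the Yang–Baxter vertex functional of the hole root in `(π/3, 2π/3)`.
[cite: GlazmanManolescu2019, Lemma 2.1 (statement, "in the form given in [Gl]")]
[cite: GlazmanManolescu2019, §1 (the paragraph of Fig. 2 and the remark after eq. (1))]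
[cite: Glazman2015WeightedSAW, Lemma 3.1 (proof, pp. 6–7)] [cite: DuminilCopinSmirnov2012, proof of Lemma 1]
[cite: CourantRobbins1958, Ch. V Appendix §2 (The Jordan Curve Theorem for Polygons: the even–odd rule)] -/
theorem vertexFunctional_printed_farCellW_exists_eq_zero_Ioo_of_kills_killRow (Dl : List Face) (w : Face)
    (hf : farW w ∈ Dl) (hh : holeFaceW w ∉ dom Dl) (hr : RootedFace (dom Dl) (w.side .W) (farW w))
    (hKS : killSW w ∉ dom Dl) (hKN : killNW w ∉ dom Dl)
    (hkrowS : ∀ x : ℤ, x ≤ w.1 - 4 → (x, w.2 - 2) ∉ dom Dl ∨ (x, w.2 - 3) ∉ dom Dl)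
    (hkrowN : ∀ x : ℤ, x ≤ w.1 - 4 → (x, w.2 + 2) ∉ dom Dl ∨ (x, w.2 + 3) ∉ dom Dl)
    (hN₂ : ∃ (ω : ΩG (dom Dl) (w.side .W) (farW w)) (h : ω.IsB2a), ω.2.firstSideG = .N ∧
      ω.WE (fun _ => π / 3) ≠ excursionWinding (π / 3) ω.2.firstSideG (ω.z1 hr h) ω.1 ∧ ω.2.W2FreeOff (farW w))
    (hS₁ : ∃ (ω : ΩG (dom Dl) (w.side .W) (farW w)) (h : ω.IsB2a), ω.2.firstSideG = .S ∧
      ω.WE (fun _ => 2 * π / 3) ≠ excursionWinding (2 * π / 3) ω.2.firstSideG (ω.z1 hr h) ω.1 ∧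
        ω.2.W1FreeOff (farW w)) :
    ∃ θ ∈ Set.Ioo (π / 3) (2 * π / 3),
      vertexFunctional (printedWeights θ) tFiveEighths (ybCoeff θ) Dl (w.side .W) (farW w) = 0 :=
  vertexFunctional_printed_farCellW_exists_eq_zero_Ioo_of_opposite_kills Dl w hf hh hr
    (ΩG.under_killed_of_killSW_killRow hh hKS hkrowS hr (π / 3)) hN₂
    (ΩG.over_killed_of_killNW_killRow hh hKN hkrowN hr (2 * π / 3)) hS₁

end Literature.Barriers.CriticalPhenomena.PlaquetteWalk
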